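import Summits.HubbardSuperconductivity.HubbardSuperconductivity.Theses.LogColdTorus
import Summits.HubbardSuperconductivity.HubbardSuperconductivity.Theorems.LogColdTorusUniformDescent

/-! Scratch (lead c2): the route's kill-criterion (b) pivot, checked to compose.
`LogColdDWaveOrderUniform` = crux 8807 restated UNIFORMLY in β ≥ κ log L; with the PROVED support
`uniformDescent_proof` (8809) and crux `AverageToEvery` it closes the summit with no descent crux. -/

namespace Summit.HubbardSuperconductivity.HubbardSuperconductivity.Cruxes.LogColdToGround.Pivot

open scoped Matrix ComplexConjugate Classical
open Summit.HubbardSuperconductivity.HubbardSuperconductivity.Theses.LogColdTorus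

set_option linter.dupNamespace false

/-- Proposed restatement of `LogColdDWaveOrder` (8807), uniform in `β ≥ κ log L`. -/
abbrev LogColdDWaveOrderUniform : Prop := ∃ δ ∈ Set.Ioo (0:ℝ) (1/2), ∃ U₁ U₂ : ℝ, 0 < U₁ ∧ U₁ < U₂ ∧ ∃ κ₀ c : ℝ, 0 < κ₀ ∧ 0 < c ∧ ∀ κ : ℝ, κ₀ ≤ κ → ∃ L₀ : ℕ, ∀ U ∈ Set.Ioo U₁ U₂, ∀ (L : ℕ) [NeZero L], L₀ ≤ L → Even L → ∀ β : ℝ, κ * Real.log L ≤ β → let p : Finset (Literature.MathematicalPhysics.QuantumLattice.Orb (Literature.MathematicalPhysics.QuantumLattice.FermionTorus 2 L)) → Prop := fun s => s.card = 2 * ⌊(1 - δ) * (L : ℝ) ^ 2 / 2⌋₊ ∧ 2 * (s.filter fun i => (ofLex i).2 = 0).card = 2 * ⌊(1 - δ) * (L : ℝ) ^ 2 / 2⌋₊;  c * (L : ℝ) ^ 4 ≤ (Matrix.gibbsState β ((Literature.MathematicalPhysics.QuantumLattice.hubbardTorus 2 L 1 U).toBlock p p) (((Literature.MathematicalPhysics.QuantumLattice.pairField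 Literature.MathematicalPhysics.QuantumLattice.dWaveFormFactor L)ᴴ * Literature.MathematicalPhysics.QuantumLattice.pairField Literature.MathematicalPhysics.QuantumLattice.dWaveFormFactor L).toBlock p p)).re

/-- The pivoted route closes: uniform log-cold order → (UniformDescent, proved) → AverageToEvery → summit. -/
theorem closes_of_uniform : LogColdDWaveOrderUniform → AverageToEvery → HubbardSuperconductivity := by
  intro h1 h3
  obtain ⟨δ, hδ, U₁, U₂, hU₁, hU₁₂, κ₀, c, hκ₀, hc, h⟩ := h1
  obtain ⟨L₀, hL₀⟩ := h κ₀ le_rfl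
  have hhub := Summit.HubbardSuperconductivity.HubbardSuperconductivity.Theorems.LogColdTorus.uniformDescent_proof
    δ U₁ U₂ κ₀ c L₀ hc hL₀
  obtain ⟨U, hU, hLRO⟩ := h3 δ U₁ U₂ c L₀ hU₁ hU₁₂ hc hhub
  unfold HubbardSuperconductivity Literature.Hubbard.DWaveSuperconductivityHubbard
  exact ⟨U, lt_trans hU₁ hU.1, δ, hδ, hLRO⟩

/-- And the uniform form trivially gives the pointwise crux 8807 (β := κ log L). -/
theorem logColdDWaveOrder_of_uniform : LogColdDWaveOrderUniform → LogColdDWaveOrder := by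
  intro h1
  obtain ⟨δ, hδ, U₁, U₂, hU₁, hU₁₂, κ₀, c, hκ₀, hc, h⟩ := h1
  refine ⟨δ, hδ, U₁, U₂, hU₁, hU₁₂, κ₀, c, hκ₀, hc, fun κ hκ => ?_⟩
  obtain ⟨L₀, hL₀⟩ := h κ hκ
  exact ⟨L₀, fun U hU L _ hL hev => hL₀ U hU L hL hev (κ * Real.log L) le_rfl⟩

end Summit.HubbardSuperconductivity.HubbardSuperconductivity.Cruxes.LogColdToGround.Pivot
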